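import Mathlib

set_option linter.dupNamespace false

/-!
# `SnSubsetDichotomy.HyperoctahedralSubsets`, line `spherical-rank-sieve` — `stub_shortReturn`

Minimal coincidence of a non-injective closed walk (crux `stmt-MatrixMultiplication-8305`,
registered stub `stub_shortReturn` of the lead's skeleton for line `spherical-rank-sieve`).

Setting: `μ 0, μ 1, μ 2` are fixed-point-free involutions of `Fin n`; a cyclic colour word
`col : Fin (k + 2) → Fin 3` is cyclically non-backtracking (`col i ≠ col (i + 1)`, indices in
`Fin (k + 2)`, addition wraps); a closed walk of `col` is `p : Fin (k + 2) → Fin n` with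
`μ (col i) (p i) = p (i + 1)` for all `i`.  If `p` is not injective, there is an arc
`s, s + 1, …, s + d + 1` of `d + 2` indices with `2 (d + 2) ≤ k + 2` along which `p` closes up
(`p (s + d + 2) = p s`) and whose colour word is again cyclically non-backtracking
(`col (s + d + 1) ≠ col s`).  In the statement the arc is presented through
`j ↦ s + Fin.castLE hd j`, `j : Fin (d + 2)`.

Proof.  Indices are transported to `ℕ` with period `k + 2` (`P m := p ↑m`, `C m := col ↑m`).
Among all coincidences `P a = P (a + g)` with `g ≥ 1` take one of minimal gap `g`
(`ShortReturn.minGap`): the reversed coincidence `P (a + g) = P (a + g + (k + 2 - g))` gives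
`2 g ≤ k + 2`; `g ≠ 1` by fixed-point-freeness; and if `C (a + g - 1) = C a =: c`, applying the
involution `μ c` to `P a = P (a + g)` gives `P (a + 1) = P (a + g - 1)`
(`ShortReturn.back_of_inv`), a backtrack `C (a + 1) = C a` for `g = 2` and a coincidence of
smaller gap `g - 2 ≥ 1` for `g ≥ 3`.  `ShortReturn.arc_of_window` converts the window back to
the `Fin (d + 2)`-indexed arc.
-/

namespace Summit.MatrixMultiplication.MatrixMultiplication.Theorems.HyperoctahedralSubsets

namespace ShortReturn

/-- **Minimal gap.**  For an `N`-periodic sequence `P` without immediate repetitions, a colouring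
`C` without immediate repetitions, the backtrack rule
`P a = P (a + d + 2) → C (a + d + 1) = C a → P (a + 1) = P (a + d + 1)` and some repetition
`P a = P (a + g)` with `1 ≤ g < N`, there is a repetition `P a = P (a + d + 2)` with
`2 (d + 2) ≤ N` and `C (a + d + 1) ≠ C a` (take `d + 2 :=` the minimal gap; cf. the twin line's
`HyperoctahedralThreshold.Extract.window_of_rep`, the same argument for rung walks). [folklore] -/
theorem minGap {α β : Type*} (P : ℕ → α) (C : ℕ → β) (N : ℕ)
    (hnl : ∀ i, P i ≠ P (i + 1)) (hnb : ∀ i, C i ≠ C (i + 1))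
    (hback : ∀ a d, P a = P (a + d + 2) → C (a + d + 1) = C a → P (a + 1) = P (a + d + 1))
    (hper : ∀ i, P (i + N) = P i)
    (hrep : ∃ g, 1 ≤ g ∧ g < N ∧ ∃ a, P a = P (a + g)) :
    ∃ a d, 2 * (d + 2) ≤ N ∧ P a = P (a + d + 2) ∧ C (a + d + 1) ≠ C a := by
  classical
  have hex : ∃ g, 1 ≤ g ∧ ∃ a, P a = P (a + g) := by
    obtain ⟨g, hg1, -, hg⟩ := hrep
    exact ⟨g, hg1, hg⟩
  obtain ⟨hg1, a, ha⟩ := Nat.find_spec hex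
  have hmin : ∀ g', g' < Nat.find hex → ¬ (1 ≤ g' ∧ ∃ a, P a = P (a + g')) :=
    fun g' h => Nat.find_min hex h
  have hgN : Nat.find hex < N := by
    obtain ⟨g, hg1', hgN, hg⟩ := hrep
    exact lt_of_le_of_lt (Nat.find_min' hex ⟨hg1', hg⟩) hgN
  have h2 : 2 * Nat.find hex ≤ N := by
    by_contra h
    refine hmin (N - Nat.find hex) (by omega) ⟨by omega, a + Nat.find hex, ?_⟩
    rw [show a + Nat.find hex + (N - Nat.find hex) = a + N by omega, hper, ha]
  have hg2 : 2 ≤ Nat.find hex := by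
    by_contra h
    have h1 : Nat.find hex = 1 := by omega
    rw [h1] at ha
    exact hnl a ha
  refine ⟨a, Nat.find hex - 2, by omega, ?_, ?_⟩
  · rwa [show a + (Nat.find hex - 2) + 2 = a + Nat.find hex by omega]
  · intro hc
    have hb : P (a + 1) = P (a + (Nat.find hex - 2) + 1) :=
      hback a (Nat.find hex - 2)
        (by rwa [show a + (Nat.find hex - 2) + 2 = a + Nat.find hex by omega]) hc
    rcases Nat.lt_or_ge (Nat.find hex) 3 with hg3 | hg3
    · rw [show a + (Nat.find hex - 2) + 1 = a + 1 by omega] at hc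
      exact hnb a hc.symm
    · refine hmin (Nat.find hex - 2) (by omega) ⟨by omega, a + 1, ?_⟩
      rwa [show a + 1 + (Nat.find hex - 2) = a + (Nat.find hex - 2) + 1 by omega]

/-- The backtrack rule for a walk `P` of involutions along the colours `C`: if
`P a = P (a + d + 2)` and `C (a + d + 1) = C a =: c`, then
`P (a + 1) = μ c (P a) = μ c (P (a + d + 2)) = μ c (μ c (P (a + d + 1))) = P (a + d + 1)`.
[folklore] -/
theorem back_of_inv {n : ℕ} (μ : Fin 3 → Equiv.Perm (Fin n)) (P : ℕ → Fin n)
    (C : ℕ → Fin 3) (hinv : ∀ c v, μ c (μ c v) = v) (hP : ∀ m, μ (C m) (P m) = P (m + 1))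
    (a d : ℕ) (hcl : P a = P (a + d + 2)) (hc : C (a + d + 1) = C a) :
    P (a + 1) = P (a + d + 1) := by
  have h1 : μ (C (a + d + 1)) (P (a + d + 1)) = P (a + d + 2) := hP (a + d + 1)
  rw [← hP a, hcl, ← h1, hc, hinv]

/-- From an `ℕ`-indexed window `P a = P (a + d + 2)`, `C (a + d + 1) ≠ C a` of a walk
(`f (C m) (P m) = P (m + 1)`, `C m ≠ C (m + 1)`) to the `Fin (d + 2)`-indexed cyclic arc: the
step and the colour clause at `j` and `j + 1` (the content is the wrap `j = Fin.last (d + 1)`).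
[folklore] -/
theorem arc_of_window {α β : Type*} (P : ℕ → α) (C : ℕ → β) (f : β → α → α)
    (a d : ℕ) (hP : ∀ m, f (C m) (P m) = P (m + 1)) (hC : ∀ m, C m ≠ C (m + 1))
    (hcl : P a = P (a + d + 2)) (hcyc : C (a + d + 1) ≠ C a) (j : Fin (d + 2)) :
    f (C (a + j)) (P (a + j)) = P (a + ((j + 1 : Fin (d + 2)) : ℕ)) ∧
      C (a + j) ≠ C (a + ((j + 1 : Fin (d + 2)) : ℕ)) := by
  rw [Fin.val_add_one]
  split_ifs with h
  · rw [h, Fin.val_last, add_zero]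
    refine ⟨?_, hcyc⟩
    rw [hP, hcl, show a + (d + 1) + 1 = a + d + 2 by omega]
  · rw [← Nat.add_assoc]
    exact ⟨hP _, hC _⟩

end ShortReturn

open Fin.NatCast in
/-- **Minimal coincidence** (stub `stub_shortReturn` of line `spherical-rank-sieve`): a closed
walk `p` of a cyclically non-backtracking word `col` of length `k + 2` in the fixed-point-free
involutions `μ 0, μ 1, μ 2` that is NOT injective contains a closed sub-walk along an arc
`s, s + 1, …, s + d + 1` of `Fin (k + 2)` with `2 (d + 2) ≤ k + 2` whose colour word is again
cyclically non-backtracking. [folklore] -/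
theorem stub_shortReturn : ∀ (n k : ℕ) (μ : Fin 3 → Equiv.Perm (Fin n)) (col : Fin (k + 2) → Fin 3) (p : Fin (k + 2) → Fin n), (∀ c, μ c * μ c = 1) → (∀ c v, μ c v ≠ v) → (∀ i, col i ≠ col (i + 1)) → (∀ i, μ (col i) (p i) = p (i + 1)) → ¬ Function.Injective p → ∃ (d : ℕ) (hd : d + 2 ≤ k + 2) (s : Fin (k + 2)), 2 * (d + 2) ≤ k + 2 ∧ (∀ j : Fin (d + 2), μ (col (s + Fin.castLE hd j)) (p (s + Fin.castLE hd j)) = p (s + Fin.castLE hd (j + 1))) ∧ (∀ j : Fin (d + 2), col (s + Fin.castLE hd j) ≠ col (s + Fin.castLE hd (j + 1))) := by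
  intro n k μ col p hinv hfpf hnb hstep hninj
  have hinv' : ∀ c v, μ c (μ c v) = v := fun c v => by
    simpa only [Equiv.Perm.mul_apply, Equiv.Perm.one_apply] using
      congrArg (fun f : Equiv.Perm (Fin n) => f v) (hinv c)
  have hsucc : ∀ m : ℕ, ((m + 1 : ℕ) : Fin (k + 2)) = (m : Fin (k + 2)) + 1 := fun m =>
    Nat.cast_succ m
  -- the walk, transported to `ℕ`-periodic data
  have hP : ∀ m : ℕ, μ (col (m : Fin (k + 2))) (p m) = p ((m + 1 : ℕ) : Fin (k + 2)) :=
    fun m => by rw [hsucc]; exact hstep _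
  have hC : ∀ m : ℕ, col (m : Fin (k + 2)) ≠ col ((m + 1 : ℕ) : Fin (k + 2)) :=
    fun m => by rw [hsucc]; exact hnb _
  have hnl : ∀ m : ℕ, p (m : Fin (k + 2)) ≠ p ((m + 1 : ℕ) : Fin (k + 2)) :=
    fun m => by rw [← hP]; exact (hfpf _ _).symm
  have hper : ∀ m : ℕ, p ((m + (k + 2) : ℕ) : Fin (k + 2)) = p (m : Fin (k + 2)) :=
    fun m => by rw [Nat.cast_add, Fin.natCast_self, add_zero]
  -- a coincidence, read in `ℕ`
  have hrep : ∃ g, 1 ≤ g ∧ g < k + 2 ∧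
      ∃ a : ℕ, p (a : Fin (k + 2)) = p ((a + g : ℕ) : Fin (k + 2)) := by
    obtain ⟨a, b, hab, hne⟩ := Function.not_injective_iff.mp hninj
    rcases Fin.lt_or_lt_of_ne hne with h | h
    · have h' : a.val < b.val := h
      refine ⟨b - a, by omega, by omega, a, ?_⟩
      rw [show (a : ℕ) + (b - a : ℕ) = b by omega, Fin.cast_val_eq_self, Fin.cast_val_eq_self]
      exact hab
    · have h' : b.val < a.val := h
      refine ⟨a - b, by omega, by omega, b, ?_⟩
      rw [show (b : ℕ) + (a - b : ℕ) = a by omega, Fin.cast_val_eq_self, Fin.cast_val_eq_self]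
      exact hab.symm
  obtain ⟨a, d, h2, hcl, hcyc⟩ := ShortReturn.minGap (fun m => p m) (fun m => col m) (k + 2)
    hnl hC (fun a d h hc => ShortReturn.back_of_inv μ _ _ hinv' hP a d h hc) hper hrep
  have hd : d + 2 ≤ k + 2 := by omega
  have hcast : ∀ i : Fin (d + 2),
      (a : Fin (k + 2)) + Fin.castLE hd i = ((a + (i : ℕ) : ℕ) : Fin (k + 2)) := by
    intro i
    rw [Nat.cast_add]
    congr 1
    exact Fin.ext (Nat.mod_eq_of_lt (lt_of_lt_of_le i.isLt hd)).symm
  refine ⟨d, hd, a, h2, fun j => ?_, fun j => ?_⟩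
  · rw [hcast j, hcast (j + 1)]
    exact (ShortReturn.arc_of_window (fun m => p m) (fun m => col m) (fun c v => μ c v) a d
      hP hC hcl hcyc j).1
  · rw [hcast j, hcast (j + 1)]
    exact (ShortReturn.arc_of_window (fun m => p m) (fun m => col m) (fun c v => μ c v) a d
      hP hC hcl hcyc j).2

end Summit.MatrixMultiplication.MatrixMultiplication.Theorems.HyperoctahedralSubsets
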